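import Literature.MathematicalPhysics.KineticTheory.HardSphereEulerProofs
import HarnessLib

/-!
# `CollisionActivityTails` (stmt-AtomisticToContinuum-13734), line `SketchK1`: the near-field kinetic tail
statement is EXACTLY a one-sided law of large numbers (level form)

Helper file (`--supports stmt-AtomisticToContinuum-13734`) for the crux
`Summit.AtomisticToContinuum.HydrodynamicLimit.Theses.TwoClocks.CollisionActivityTails`
(≡ `…Theses.OneFlightGossipEngine.CollisionActivityTails`), skeleton line `SketchK1`
(`Cruxes/CollisionActivityTails/Lines/SketchK1.lean`), registered stub
`stub_nearFieldKineticTailsIffExcessDecay` — a REFORMULATION helper of the open stub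
`stub_nearFieldKineticTails : NearFieldKineticTails` (stub 5 of the line).

`NearFieldKineticTails ↔ NearFieldKineticExcessDecay`: the crux-shaped tail statement for the window-averaged
near-field relative kinetic energy `F²_i` (threshold `V₀` quantified BEFORE the accuracy, then `τ → ∞` after
`N → ∞`) is equivalent — by pure scalar algebra (`𝟙{V < y} y ≤ V/(V−m)·(y − m)₊` for `m < V`,
`(y − V)₊ ≤ 𝟙{V < y} y`) and monotonicity of `∫⁻`, with no measurability and no dynamics — to the LEVEL form:
there is a level `m ≥ 0` above which the activity-weighted `L¹` excess `(N+1)⁻¹ Σ_i (F²_i − m)₊` vanishes as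
`τ → ∞` after `N → ∞`, uniformly in `s ≤ t < T`. This pins down the missing fact behind stub 5 as a tagged-particle,
ONE-SIDED law of large numbers in the window length for the co-moving `2ε`-ball relative kinetic energy under the
TRUE law (its `L¹`-limsup is essentially at most `m`); by the standing Disproof (§3, `exists_uiShape_moments_not_cruxShape`)
no family of moment bounds can supply it, only time-decorrelation. The same algebra applies verbatim to the crux's
own activity functional and to the crowded-collision stub.

References: the scalar inequalities are folklore (Chebyshev-type level comparison); H. Spohn, *Large Scale Dynamics of
Interacting Particles* (1991), Part I §2.3 for the local Gibbs laws.
-/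

noncomputable section

open MeasureTheory Set Filter Topology
open scoped ENNReal

namespace Summit.AtomisticToContinuum.HydrodynamicLimit.Theorems.CollisionActivityTailsNearFieldKineticExcess

open Literature.MathematicalPhysics.KineticTheory Literature.Analysis.FluidPDE

/-! ## Vocabulary of the line (verbatim from the skeleton `SketchK1`) -/

/-- A hard-sphere flow of `N + 1` spheres of reduced diameter `σ` on `𝕋³` (the crux's `Φ N`). -/
abbrev Flow (σ : ℝ) (N : ℕ) : Type :=
  HardSphereFlow (Torus.geometry (Fin 3)) (hsDiameter σ N) (N + 1)

/-- Phase space of `N + 1` spheres on `𝕋³`. -/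
abbrev Cfg (N : ℕ) : Type := Config (N + 1) (Fin 3) T3

/-- The crux's window `w_N = τ (N+1)^{-1/3}`. -/
def window (τ : ℝ) (N : ℕ) : ℝ := τ * ((N : ℝ) + 1) ^ (-(1 / 3 : ℝ))

/-- The scalar tail functional `y ↦ 𝟙{V < y} y` (the crux's integrand is `(N+1)⁻¹ Σ_i tailFn V (a_i)`). -/
def tailFn (V y : ℝ) : ℝ := Set.indicator {y : ℝ | V < y} (fun y => y) y

/-- Minimal-image distance of two points of `𝕋³` (norm of the torus geometry's separation vector). -/
def tdist (x y : T3) : ℝ := ‖(Torus.geometry (Fin 3)).sepVec x y‖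

/-- Near-field relative kinetic energy at `i`: `Σ_{j ≠ i, dist(x_j, x_i) ≤ r} |v_j − v_i|²`. -/
def relKineticNear {N : ℕ} (z : Cfg N) (i : Fin (N + 1)) (r : ℝ) : ℝ :=
  ∑ j : Fin (N + 1), if j ≠ i ∧ tdist (z j).1 (z i).1 ≤ r then ‖(z j).2 - (z i).2‖ ^ 2 else 0

/-- `F²_i`: NEAR-FIELD KINETIC TERM — the window average of the near-field (radius `2ε`) relative kinetic energy at `i`
along the orbit. -/
def nearFieldKinetic {σ : ℝ} {N : ℕ} (Φ : Flow σ N) (τ s : ℝ) (i : Fin (N + 1)) (z : Cfg N) : ℝ :=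
  (window τ N)⁻¹ * ∫ t in s..(s + window τ N), relKineticNear (Φ.flow t z) i (2 * hsDiameter σ N)

/-- **NEAR-FIELD KINETIC TAILS** (stub 5 of line `SketchK1`, OPEN; verbatim from the skeleton). In the crux's own frame
and quantifier shape: the `L¹` tail of `F²_i` above `V ≥ V₀` vanishes as `τ → ∞` after `N → ∞`, uniformly in
`s ≤ t < T`. -/
def NearFieldKineticTails : Prop :=
  ∀ (a₀ θ₀ : T3 → ℝ) (u₀ : T3 → V3), Continuous a₀ → Continuous θ₀ → Continuous u₀ →
    (∀ x, 0 < a₀ x) → (∀ x, 0 < θ₀ x) → ∃ σ₀ : ℝ, 0 < σ₀ ∧ ∀ σ : ℝ, 0 < σ → σ < σ₀ →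
    ∀ (T : ℝ) (ρ θ : ℝ → T3 → ℝ) (u : ℝ → T3 → V3), IsHardSphereEulerSolution σ T ρ u θ →
    ∀ Φ : (N : ℕ) → Flow σ N,
    TendstoHydroFieldsAt (fun N => localGibbsLaw σ a₀ u₀ θ₀ N (Φ N)) Φ ρ u θ 0 →
    ∀ t ∈ Set.Ico 0 T, ∃ V₀ : ℝ, 0 < V₀ ∧ ∀ V : ℝ, V₀ ≤ V → ∀ ε : ℝ, 0 < ε →
    ∃ τ₀ : ℝ, 0 < τ₀ ∧ ∀ τ : ℝ, τ₀ ≤ τ → ∃ N₀ : ℕ, ∀ N : ℕ, N₀ ≤ N → ∀ s ∈ Set.Icc 0 t,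
      ∫⁻ z, ENNReal.ofReal (((N : ℝ) + 1)⁻¹ * ∑ i : Fin (N + 1), tailFn V (nearFieldKinetic (Φ N) τ s i z))
        ∂(localGibbsLaw σ a₀ u₀ θ₀ N (Φ N)) ≤ ENNReal.ofReal ε

/-- **The missing fact, level form.** One-sided tagged-particle LLN in the window length for the co-moving
`2ε`-ball relative kinetic energy under the true law: above some level `m` the activity-weighted `L¹` excess
`(N+1)⁻¹ Σ_i (F²_i − m)₊` vanishes as `τ → ∞` after `N → ∞`, uniformly in `s ≤ t < T`. -/
def NearFieldKineticExcessDecay : Prop :=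
  ∀ (a₀ θ₀ : T3 → ℝ) (u₀ : T3 → V3), Continuous a₀ → Continuous θ₀ → Continuous u₀ →
    (∀ x, 0 < a₀ x) → (∀ x, 0 < θ₀ x) → ∃ σ₀ : ℝ, 0 < σ₀ ∧ ∀ σ : ℝ, 0 < σ → σ < σ₀ →
    ∀ (T : ℝ) (ρ θ : ℝ → T3 → ℝ) (u : ℝ → T3 → V3), IsHardSphereEulerSolution σ T ρ u θ →
    ∀ Φ : (N : ℕ) → Flow σ N,
    TendstoHydroFieldsAt (fun N => localGibbsLaw σ a₀ u₀ θ₀ N (Φ N)) Φ ρ u θ 0 →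
    ∀ t ∈ Set.Ico 0 T, ∃ m : ℝ, 0 ≤ m ∧ ∀ δ : ℝ, 0 < δ →
    ∃ τ₀ : ℝ, 0 < τ₀ ∧ ∀ τ : ℝ, τ₀ ≤ τ → ∃ N₀ : ℕ, ∀ N : ℕ, N₀ ≤ N → ∀ s ∈ Set.Icc 0 t,
      ∫⁻ z, ENNReal.ofReal (((N : ℝ) + 1)⁻¹ * ∑ i : Fin (N + 1), max (nearFieldKinetic (Φ N) τ s i z - m) 0)
        ∂(localGibbsLaw σ a₀ u₀ θ₀ N (Φ N)) ≤ ENNReal.ofReal δ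

/-- The two values of the tail functional: `y` on the tail `V < y`, `0` off it. -/
theorem tailFn_eq_ite (V y : ℝ) : tailFn V y = if V < y then y else 0 := by
  unfold tailFn Set.indicator
  rfl

/-- Above a level `m ≥ 0`, for `V > m`: `𝟙{V < y} y ≤ V/(V−m) · (y − m)₊`. -/
theorem tailFn_le_mul_posPart {m V : ℝ} (hm : 0 ≤ m) (hV : m < V) (y : ℝ) :
    tailFn V y ≤ V / (V - m) * max (y - m) 0 := by
  have hVm : 0 < V - m := sub_pos.2 hV
  rw [tailFn_eq_ite]
  split_ifs with h
  · rw [max_eq_left (by linarith), div_mul_eq_mul_div, le_div_iff₀ hVm]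
    nlinarith
  · exact mul_nonneg (div_nonneg (hm.trans hV.le) hVm.le) (le_max_right _ _)

/-- For `V ≥ 0`: `(y − V)₊ ≤ 𝟙{V < y} y`. -/
theorem posPart_le_tailFn {V : ℝ} (hV : 0 ≤ V) (y : ℝ) : max (y - V) 0 ≤ tailFn V y := by
  rw [tailFn_eq_ite]
  split_ifs with h
  · exact max_le (by linarith) (hV.trans h.le)
  · exact max_le (by linarith [not_lt.1 h]) le_rfl

/-- **The near-field kinetic tail statement is exactly the level-form one-sided LLN** (registered helper stub
`stub_nearFieldKineticTailsIffExcessDecay` of line `SketchK1`): `→` with `m := V₀` and `(y − V₀)₊ ≤ 𝟙{V₀ < y} y`;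
`←` with `V₀ := m + 1` and, for `V ≥ V₀`, `𝟙{V < y} y ≤ V/(V−m)·(y − m)₊`, asking the excess for accuracy
`ε (V−m)/V`. -/
theorem stub_nearFieldKineticTailsIffExcessDecay : NearFieldKineticTails ↔ NearFieldKineticExcessDecay := by
  constructor
  · intro h a₀ θ₀ u₀ ha hθ hu ha0 hθ0
    obtain ⟨σ₀, hσ₀, hσ⟩ := h a₀ θ₀ u₀ ha hθ hu ha0 hθ0
    refine ⟨σ₀, hσ₀, fun σ hs hs' T ρ θ u hE Φ hL t ht => ?_⟩
    obtain ⟨V₀, hV₀, hV⟩ := hσ σ hs hs' T ρ θ u hE Φ hL t ht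
    refine ⟨V₀, hV₀.le, fun δ hδ => ?_⟩
    obtain ⟨τ₀, hτ₀, hτ⟩ := hV V₀ le_rfl δ hδ
    refine ⟨τ₀, hτ₀, fun τ hττ => ?_⟩
    obtain ⟨N₀, hN⟩ := hτ τ hττ
    refine ⟨N₀, fun N hNN s hs => le_trans (lintegral_mono fun z => ENNReal.ofReal_le_ofReal ?_) (hN N hNN s hs)⟩
    exact mul_le_mul_of_nonneg_left (Finset.sum_le_sum fun i _ => posPart_le_tailFn hV₀.le _)
      (inv_nonneg.2 (by positivity))
  · intro h a₀ θ₀ u₀ ha hθ hu ha0 hθ0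
    obtain ⟨σ₀, hσ₀, hσ⟩ := h a₀ θ₀ u₀ ha hθ hu ha0 hθ0
    refine ⟨σ₀, hσ₀, fun σ hs hs' T ρ θ u hE Φ hL t ht => ?_⟩
    obtain ⟨m, hm, hδ⟩ := hσ σ hs hs' T ρ θ u hE Φ hL t ht
    refine ⟨m + 1, by linarith, fun V hVV ε hε => ?_⟩
    have hmV : m < V := by linarith
    have hc : 0 < V / (V - m) := div_pos (by linarith) (sub_pos.2 hmV)
    obtain ⟨τ₀, hτ₀, hτ⟩ := hδ (ε / (V / (V - m))) (div_pos hε hc)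
    refine ⟨τ₀, hτ₀, fun τ hττ => ?_⟩
    obtain ⟨N₀, hN⟩ := hτ τ hττ
    refine ⟨N₀, fun N hNN s hs => ?_⟩
    have hN' := hN N hNN s hs
    calc ∫⁻ z, ENNReal.ofReal (((N : ℝ) + 1)⁻¹ * ∑ i : Fin (N + 1), tailFn V (nearFieldKinetic (Φ N) τ s i z))
          ∂(localGibbsLaw σ a₀ u₀ θ₀ N (Φ N))
        ≤ ∫⁻ z, ENNReal.ofReal (V / (V - m)) * ENNReal.ofReal (((N : ℝ) + 1)⁻¹ *
            ∑ i : Fin (N + 1), max (nearFieldKinetic (Φ N) τ s i z - m) 0) ∂(localGibbsLaw σ a₀ u₀ θ₀ N (Φ N)) := by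
          refine lintegral_mono fun z => ?_
          rw [← ENNReal.ofReal_mul hc.le]
          refine ENNReal.ofReal_le_ofReal ?_
          calc ((N : ℝ) + 1)⁻¹ * ∑ i : Fin (N + 1), tailFn V (nearFieldKinetic (Φ N) τ s i z)
              ≤ ((N : ℝ) + 1)⁻¹ * ∑ i : Fin (N + 1), V / (V - m) * max (nearFieldKinetic (Φ N) τ s i z - m) 0 :=
                mul_le_mul_of_nonneg_left (Finset.sum_le_sum fun i _ => tailFn_le_mul_posPart hm hmV _)
                  (inv_nonneg.2 (by positivity))
            _ = V / (V - m) * (((N : ℝ) + 1)⁻¹ * ∑ i : Fin (N + 1), max (nearFieldKinetic (Φ N) τ s i z - m) 0) := by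
                rw [← Finset.mul_sum, mul_left_comm]
      _ = ENNReal.ofReal (V / (V - m)) * ∫⁻ z, ENNReal.ofReal (((N : ℝ) + 1)⁻¹ *
            ∑ i : Fin (N + 1), max (nearFieldKinetic (Φ N) τ s i z - m) 0) ∂(localGibbsLaw σ a₀ u₀ θ₀ N (Φ N)) :=
          lintegral_const_mul' _ _ ENNReal.ofReal_ne_top
      _ ≤ ENNReal.ofReal (V / (V - m)) * ENNReal.ofReal (ε / (V / (V - m))) := by gcongr
      _ = ENNReal.ofReal ε := by
          rw [← ENNReal.ofReal_mul hc.le, mul_div_cancel₀ _ hc.ne']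

end Summit.AtomisticToContinuum.HydrodynamicLimit.Theorems.CollisionActivityTailsNearFieldKineticExcess

end
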